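import Literature.MathematicalPhysics.QuantumFieldTheory.Balaban1983to89.B4Eq417GaussFourier
import Literature.MathematicalPhysics.QuantumFieldTheory.Balaban1983to89.B4Ineq422

/-!
# B4 (4.14)–(4.16), (4.18), (4.19), (4.21), (4.22): the two-block computation `LHS(4.14) = A₀ψ²`, `A₀ ≥ γ₀″` in
the block model of `B4Ineq422`

T. Bałaban, *Regularity and decay of lattice Green's functions*, Commun. Math. Phys. **89** (1983) 571–597
[Balaban1983RegularityDecay] (= B4), §4, pp. 591–593 [PDF 21–23] (journal page = PDF page + 570; renders
`run/shared/lean/pub/pub-balaban/b2b-balaban-ref1/pages/1983-cmp89-regularity-decay/…-p021/p022/p023-x2.png`).  Unit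
lit-balaban-r01 gen 4 (reader/typer of block B4; row B4.Eq4.14); statement-level skeleton of published theorems with
citation tags; proofs where landed; nothing here is a claim about the Yang–Mills mass gap.

## The printed passage (pp. 591–593, verbatim from the ×2 renders)

p. 591: *"Denoting Δ = B^k(x), Δ′ = B^k(x′), ψ = φ″_k(x′) − φ″_k(x), and making the translations φ′(y) = φ(y) + φ″(x)
for y ∈ Δ, φ′(y) = φ(y) + φ″(x) for y ∈ Δ′* [sic; read `φ″(x′)` for `y ∈ Δ′`: only then does `ψ` move into the
connecting bonds as displayed in (4.16)] *in the above integral, we get"*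
p. 592: *"∫dφ|_{Δ(x,x′)} exp[−½a_k|(Q_kφ)(x)|² − ½⟨φ,(−Δ^{η,N}_Δ)φ⟩ − ½a_k|(Q_kφ)(x′)|² − ½⟨φ,(−Δ^{η,N}_{Δ′})φ⟩ −
½Σ_{b∈B(⟨x,x′⟩)} η^d|(∂^ηφ)(b) + η^{−1}ψ|²] = const exp(−½A₀|ψ|²), (4.16) where B(⟨x,x′⟩) denotes the set of all
bonds of the η-lattice connecting the block B^k(x) with the block B^k(x′), i.e. B(⟨x,x′⟩) = {b ⊂ T_η : b₋ ∈ B^k(x), b₊ ∈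
B^k(x′)}. Now we have to show that A₀ > 0, more exactly A₀ ≥ γ₀″, γ₀″ > 0, and γ₀″ depends on d and a only. … At first
we transform the last expression in the exponent:
Σ_{b∈B(⟨x,x′⟩)} η^d|(∂^ηφ)(b) + η^{−1}ψ|² = Σ_{b∈B(⟨x,x′⟩)} η^d|(∂^ηφ)(b) − Σ_{b′∈B(⟨x,x′⟩)} η^{d−1}(∂^ηφ)(b′)|² +
η^{−1}|ψ + Σ_{b∈B(⟨x,x′⟩)} η^d(∂^ηφ)(b)|². (4.18)
Let us introduce the notation ⟨φ,Aφ⟩ = a_k|(Q_kφ)(x)|² + ⟨φ,(−Δ^{η,N}_Δ)φ⟩ + a_k|(Q_kφ)(x′)|² + ⟨φ,(−Δ^{η,N}_{Δ′})φ⟩ +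
Σ_{b∈B(⟨x,x′⟩)} η^d|(∂^ηφ)(b) − Σ_{b′∈B(⟨x,x′⟩)} η^{d−1}(∂^ηφ)(b′)|². (4.19) … and we get the formula for A₀^{−1}:
A₀^{−1} = η + ⟨f_{⟨x,x′⟩}, A^{−1}f_{⟨x,x′⟩}⟩, (4.21) where f_{⟨x,x′⟩}(y) = Σ_{b∈B(⟨x,x′⟩)} η^{d−1}(δ^η(y − b₊) − δ^η(y −
b₋)). Of course both terms on the right side of (4.21) are ≧ 0, and η = L^{−k}, 0 < η < 1. We have to estimate the
second term. From (4.19) and the definition of f_{⟨x,x′⟩} it follows that"*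
p. 593: *"⟨f_{⟨x,x′⟩}, A^{−1}f_{⟨x,x′⟩}⟩ ≤ ⟨f_{⟨x,x′⟩}, G_k(Δ)f_{⟨x,x′⟩}⟩ + ⟨f_{⟨x,x′⟩}, G_k(Δ′)f_{⟨x,x′⟩}⟩ = 2Σ_{y,y′∈Δ₁}
η^{2(d−1)}G_k(Δ; y,y′), (4.22) where Δ₁ is any face of the block Δ, e.g., Δ₁ = {y ∈ Δ : y₁ = x₁ + 1 − η}. Of course the
expression on the right side of (4.22) is a constant γ₀″^{−1} depending on d and a only. Thus the inequality (4.14)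
is proved and the proof of Proposition 3.1′ is completed."*

## Typing: the block model of `B4Ineq422` (exact, finite-dimensional, plain coordinates)

`Δ ≅ Δ′ ≅ Blk D n = (Fin D → Fin n)` (`n = η⁻¹ = L^k` sites per direction, `D = d`), the two-block region is
`TwoBlk D n = Blk D n ⊕ Blk D n` (`inl` = `Δ = B^k(x)`, `inr` = `Δ′ = B^k(x′)`, `x′ = x + e_i`).  The connecting bonds
`B(⟨x,x′⟩)` are `b = ⟨inl y, inr (across i y)⟩` for `y` in the last layer `layer i (top n)` of `Δ` (`y_i = n − 1`),
`across i y = (y with y_i := 0)` its neighbour in `Δ′`; their number is `n^{D−1} = η^{1−D}` (`card_layer_mul`).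
Normalisations as in `B4Ineq422` (p. 572 (1.3)–(1.5)): `(∂^ηφ)(b) = η⁻¹(φ(b₊) − φ(b₋))`, `(Q_kφ)(y) = η^DΣ_{B^k(y)}φ =
mean φ`, `⟨φ,(−Δ^{η,N}_Δ)φ⟩ = η^{D−2}·dirichlet φ`, so that `a_k|(Q_kφ)(x)|² + ⟨φ,(−Δ^{η,N}_Δ)φ⟩ = qform a φ` (the
one-block form, matrix `Mform D n a`, Green's function `G_k(Δ;y,y′) = (Mform D n a)⁻¹ y y′`) and
`η^d|(∂^ηφ)(b) + η⁻¹ψ|² = η^{D−2}(φ(b₊) − φ(b₋) + ψ)²` with `η^{D−2} = n²/n^D`, `η^{D−1} = n/n^D` (the value of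
`faceVec`), `η⁻¹ = n`.  In these plain coordinates the form (4.19) is the matrix `form419 n i a` on `TwoBlk D n`, the
functional `⟨f_{⟨x,x′⟩},φ⟩ = Σ_bη^{d−1}(φ(b₊) − φ(b₋))` is `fvec n i ⬝ᵥ φ` with `fvec n i = (−faceVec i (top n)) ⊕
(faceVec i 0)`, and `⟨f,A⁻¹f⟩`, `⟨f,G_k(Δ)f⟩` are `fvec ⬝ form419⁻¹ fvec`, `faceVec ⬝ Mform⁻¹ faceVec` (the latter
`= η^{2(d−1)}Σ_{y,y′∈Δ₁}G_k(Δ;y,y′)` by `B4Ineq422.faceVec_dotProduct_mulVec`).  The constant `a` of `Mform D n a` is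
the print's `a_k` (> 0).

## What is proved (kernel-checked, 0 sorry; definitions with bodies + theorems; no named fact)

* §1 geometry of the two blocks: `top`, `across`, `TwoBlk`, the bond-sum reindexing `sum_across` and the bond count
  `card_layer_mul` (`|B(⟨x,x′⟩)|·η^{D−1} = 1`).
* §2 **(4.18)** `eq418` (abstract: any finite bond set `F` with `|F|κ = 1`) and `eq418_twoBlock`.
* §3 **(4.19)** `bvec`/`fvec`/`cvec`/`blockDiag`/`varMat`/`form419` with `dotProduct_form419_mulVec_self` (the form IS
  (4.19)), `fvec_dotProduct` (`⟨f,φ⟩ = Σ_bη^{d−1}(φ(b₊) − φ(b₋))`), symmetry and positive definiteness.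
* §4 **(4.16) with (4.21)** `eq416_twoBlock`: the integral of (4.16) equals `const·exp(−½A₀ψ²)` with
  `A₀ = A0 i a`, **`(A0 i a)⁻¹ = η + ⟨f,A⁻¹f⟩`** (`eq421_twoBlock`) — by (4.18) and the abstract `B4Eq417GaussFourier.eq416`.
* §5 **(4.22)**: `ineq422_twoBlock` — *"⟨f,A^{−1}f⟩ ≤ ⟨f,G_k(Δ)f⟩ + ⟨f,G_k(Δ′)f⟩"* (Löwner monotonicity of the inverse,
  dropping the last, nonnegative, term of (4.19); block-diagonal inverse), then with `B4Ineq422.ineq422` (the cell's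
  certificate of *"the expression on the right side of (4.22) is a constant γ₀″^{−1}"*, for BOTH faces `y_i = n − 1` of
  `Δ` and `y_i = 0` of `Δ′`): `fAf_le` `⟨f,A⁻¹f⟩ ≤ 4max{1,a⁻¹}`, **`A0_inv_le`** `A₀⁻¹ ≤ 1 + 4max{1,a⁻¹} = γ₀″⁻¹`
  (the constant of `B4Ineq422.gamma0_inv_le`) and **`gamma0''_le_A0`** `A₀ ≥ γ₀″ := (1 + 4max{1,a⁻¹})⁻¹ > 0` — *"A₀ ≥
  γ₀″, γ₀″ > 0, and γ₀″ depends on d and a only"* (here: on `a` only), uniformly in `η = 1/n` and `D`.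
* §6 **(4.15) = (4.16)** by the translations of p. 591 (`eq415_twoBlock`, `integrand415_shift`,
  `integral415_eq_integral416`; `Kform` = `a_kQ_k^*Q_k + (−Δ^{η,N}_{Δ(x,x′)})` in plain coordinates, `lhs414` = the
  left side of (4.14)), hence **`lhs414_eq`: the left side of (4.14) equals `A₀|φ″(x′) − φ″(x)|²` exactly**, and
  **`ineq414_blockModel`**: (4.14) with `γ₀″ = (1 + 4max{1,a_k⁻¹})⁻¹` — *"Thus the inequality (4.14) is proved"* —
  in the block model (the tree's (4.14) for its own lattice objects is `B4Ineq414TwoBlock.ineq414`, by another route).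
Not restated here: (4.17), (4.20) (abstract in `B4Eq417GaussFourier`, r01 p249902).  ABSTRACT COUNTERPARTS (Phase-2
seat p13 gen 5, `B4Eq416Fourier`, p250141, over arbitrary site/bond types with the bond count `#B·η^{d−1} = 1` as a
hypothesis `hN`): `eq418`, `formA`/`matA`/`dotProduct_A1_le_matA` ((4.19)), `eq416`/`eq421` (Schur-complement form),
`ineq422_le`/`ineq422_le_blocks`, `integral_eq415_eq_lhs416`/`lhs414_eq_A0_mul_sq`/`ineq414_iff_le_A0`.  THIS file is
the CONCRETE instance in the block model of `B4Ineq422` (owner's division of 2026-08-21, HOME/STATUS): every hypothesis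
discharged (`hN` is `card_layer_mul`), the face functionals identified with `B4Ineq422.faceVec`, and the explicit
`γ₀″ = (1 + 4max{1,a_k⁻¹})⁻¹` of `B4Ineq422.gamma0_inv_le` reached as a theorem about `A₀` (`gamma0''_le_A0`,
`ineq414_blockModel`); it is self-contained over `B4Eq417GaussFourier` + `B4Ineq422` (no import of `B4Eq416Fourier`).
-/

namespace Literature.MathematicalPhysics.QuantumFieldTheory.Balaban1983to89.B4Eq418TwoBlockA0

open MeasureTheory Matrix Finset
open Literature.MathematicalPhysics.QuantumFieldTheory.Balaban1983to89.B13GaugeDevices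
open Literature.MathematicalPhysics.QuantumFieldTheory.Balaban1983to89.B4Ineq422
open Literature.MathematicalPhysics.QuantumFieldTheory.Balaban1983to89.B4Eq417GaussFourier

noncomputable section

variable {D n : ℕ}

/-! ## §1. The two blocks and the connecting bonds `B(⟨x,x′⟩)` -/

/-- the two-block region `Δ(x,x′) = B^k(x) ∪ B^k(x′)` in the block model: `inl` = `Δ`, `inr` = `Δ′`.
[cite: Balaban1983RegularityDecay, (4.16) p.592] -/
abbrev TwoBlk (D n : ℕ) := Blk D n ⊕ Blk D n

/-- the last layer index `n − 1` of `Δ` in direction `i` (the face `Δ₁ = {y ∈ Δ : y_i = x_i + 1 − η}` of p. 593).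
[cite: Balaban1983RegularityDecay, (4.22) p.593] -/
def top (n : ℕ) [NeZero n] : Fin n := ⟨n - 1, Nat.sub_lt (NeZero.pos n) Nat.one_pos⟩

/-- the neighbour across the face: for `y ∈ Δ` with `y_i = n − 1`, the end `b₊ ∈ Δ′` of the connecting bond
`b = ⟨y, y + ηe_i⟩` has `i`-th coordinate `0` in `Δ′`'s coordinates. [cite: Balaban1983RegularityDecay, (4.16) p.592] -/
def across [NeZero n] (i : Fin D) (y : Blk D n) : Blk D n := Function.update y i 0

/-- `across` maps the last layer of `Δ` to the first layer of `Δ′`. [cite: Balaban1983RegularityDecay, (4.16) p.592] -/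
theorem across_mem [NeZero n] (i : Fin D) (y : Blk D n) : across i y ∈ layer i 0 := by
  simp [mem_layer, across]

/-- reindexing a sum over the connecting bonds by their ends in `Δ′`:
`Σ_{y ∈ Δ, y_i = n−1} G(across y) = Σ_{y′ ∈ Δ′, y′_i = 0} G(y′)`. [cite: Balaban1983RegularityDecay, (4.16) p.592] -/
theorem sum_across [NeZero n] (i : Fin D) (G : Blk D n → ℝ) :
    ∑ y ∈ layer i (top n), G (across i y) = ∑ y' ∈ layer i 0, G y' := by
  refine Finset.sum_nbij' (across i) (fun y' => Function.update y' i (top n)) (fun y _ => across_mem i y)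
    (fun y' _ => by simp [mem_layer]) (fun y hy => ?_) (fun y' hy' => ?_) (fun y _ => rfl)
  · rw [mem_layer] at hy
    rw [across, Function.update_idem, ← hy, Function.update_eq_self]
  · rw [mem_layer] at hy'
    rw [across, Function.update_idem, ← hy', Function.update_eq_self]

/-- the bond count: `|B(⟨x,x′⟩)| = n^{D−1}`, i.e. `|B(⟨x,x′⟩)|·η^{D−1} = 1` (`η^{D−1} = n/n^D`).
[cite: Balaban1983RegularityDecay, (4.18) p.592] -/
theorem card_layer_mul [NeZero n] (i : Fin D) (c : Fin n) :
    ((layer i c).card : ℝ) * ((n : ℝ) / (n : ℝ) ^ D) = 1 := by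
  have h := sum_update_eq i c (fun _ => (1 : ℝ))
  simp only [Finset.sum_const, Finset.card_univ, Fintype.card_pi, Fintype.card_fin, Finset.prod_const,
    nsmul_eq_mul, mul_one] at h
  have hn : (n : ℝ) ≠ 0 := by exact_mod_cast NeZero.ne n
  have hnD : (n : ℝ) ^ D ≠ 0 := pow_ne_zero _ hn
  rw [mul_div_assoc', div_eq_one_iff_eq hnD, mul_comm]
  exact_mod_cast h.symm

/-! ## §2. (4.18): completing the square in `ψ` -/

/-- **(4.18)**, abstract form: for a finite bond set `F` with `|F|·κ = 1` (κ = `η^{d−1}`, `ν = η⁻¹`, `νκ = η^{d−2}`;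
`g_b = φ(b₊) − φ(b₋)`): `νκΣ_b(g_b + ψ)² = νκΣ_b(g_b − κΣ_{b′}g_{b′})² + ν(ψ + κΣ_bg_b)²` — print: *"Σ_bη^d|(∂^ηφ)(b) +
η^{−1}ψ|² = Σ_bη^d|(∂^ηφ)(b) − Σ_{b′}η^{d−1}(∂^ηφ)(b′)|² + η^{−1}|ψ + Σ_bη^d(∂^ηφ)(b)|²"*.
[cite: Balaban1983RegularityDecay, (4.18) p.592] -/
theorem eq418 {α : Type*} (F : Finset α) (g : α → ℝ) {κ : ℝ} (ν : ℝ) (hF : (F.card : ℝ) * κ = 1) (ψ : ℝ) :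
    ν * κ * ∑ y ∈ F, (g y + ψ) ^ 2
      = ν * κ * ∑ y ∈ F, (g y - κ * ∑ y' ∈ F, g y') ^ 2 + ν * (ψ + κ * ∑ y ∈ F, g y) ^ 2 := by
  have e1 : ∑ y ∈ F, (g y + ψ) ^ 2 = ∑ y ∈ F, g y ^ 2 + 2 * ψ * ∑ y ∈ F, g y + F.card * ψ ^ 2 := by
    have h : ∀ y, (g y + ψ) ^ 2 = g y ^ 2 + 2 * ψ * g y + ψ ^ 2 := fun y => by ring
    simp_rw [h, Finset.sum_add_distrib, ← Finset.mul_sum, Finset.sum_const, nsmul_eq_mul]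
  have e2 : ∑ y ∈ F, (g y - κ * ∑ y' ∈ F, g y') ^ 2
      = ∑ y ∈ F, g y ^ 2 - 2 * (κ * ∑ y' ∈ F, g y') * ∑ y ∈ F, g y + F.card * (κ * ∑ y' ∈ F, g y') ^ 2 := by
    have h : ∀ y, (g y - κ * ∑ y' ∈ F, g y') ^ 2
        = g y ^ 2 - 2 * (κ * ∑ y' ∈ F, g y') * g y + (κ * ∑ y' ∈ F, g y') ^ 2 := fun y => by ring
    simp_rw [h, Finset.sum_add_distrib, Finset.sum_sub_distrib, ← Finset.mul_sum, Finset.sum_const, nsmul_eq_mul]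
  rw [e1, e2]
  linear_combination (ν * ψ ^ 2 - ν * κ ^ 2 * (∑ y ∈ F, g y) ^ 2) * hF

/-- **(4.18) in the block model**: with `g_y = φ(inr (across y)) − φ(inl y)` over the last layer of `Δ`,
`(n²/n^D)Σ_y(g_y + ψ)² = (n²/n^D)Σ_y(g_y − (n/n^D)Σ_{y′}g_{y′})² + n(ψ + (n/n^D)Σ_yg_y)²`.
[cite: Balaban1983RegularityDecay, (4.18) p.592] -/
theorem eq418_twoBlock [NeZero n] (i : Fin D) (g : Blk D n → ℝ) (ψ : ℝ) :
    (n : ℝ) ^ 2 / (n : ℝ) ^ D * ∑ y ∈ layer i (top n), (g y + ψ) ^ 2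
      = (n : ℝ) ^ 2 / (n : ℝ) ^ D *
          ∑ y ∈ layer i (top n), (g y - (n : ℝ) / (n : ℝ) ^ D * ∑ y' ∈ layer i (top n), g y') ^ 2
        + (n : ℝ) * (ψ + (n : ℝ) / (n : ℝ) ^ D * ∑ y ∈ layer i (top n), g y) ^ 2 := by
  have h := eq418 (layer i (top n)) g (n : ℝ) (card_layer_mul i (top n)) ψ
  have e : (n : ℝ) * ((n : ℝ) / (n : ℝ) ^ D) = (n : ℝ) ^ 2 / (n : ℝ) ^ D := by ring
  rw [e] at h
  exact h

/-! ## §3. (4.19): the form `⟨φ,Aφ⟩` and the functional `f_{⟨x,x′⟩}` in plain coordinates -/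

/-- pairing with a vector on the two-block region splits into the two blocks. [cite: Balaban1983RegularityDecay, (4.19) p.592] -/
theorem dotProduct_sumElim {α β : Type*} [Fintype α] [Fintype β] (φ : α ⊕ β → ℝ) (u : α → ℝ) (v : β → ℝ) :
    φ ⬝ᵥ Sum.elim u v = (fun a => φ (Sum.inl a)) ⬝ᵥ u + (fun b => φ (Sum.inr b)) ⬝ᵥ v := by
  simp [dotProduct, Fintype.sum_sum_type]

/-- the bond functional of the connecting bond at `y`: `bvec y ⬝ φ = φ(b₊) − φ(b₋) = η(∂^ηφ)(b)`.
[cite: Balaban1983RegularityDecay, (4.16) p.592] -/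
def bvec [NeZero n] (i : Fin D) (y : Blk D n) : TwoBlk D n → ℝ :=
  Sum.elim (-(Pi.single y 1)) (Pi.single (across i y) 1)

/-- `bvec y ⬝ φ = φ(inr (across y)) − φ(inl y)`. [cite: Balaban1983RegularityDecay, (4.16) p.592] -/
theorem bvec_dotProduct [NeZero n] (i : Fin D) (y : Blk D n) (φ : TwoBlk D n → ℝ) :
    bvec i y ⬝ᵥ φ = φ (Sum.inr (across i y)) - φ (Sum.inl y) := by
  rw [dotProduct_comm, bvec, dotProduct_sumElim, dotProduct_neg, dotProduct_comm _ (Pi.single y (1 : ℝ)),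
    dotProduct_comm _ (Pi.single (across i y) (1 : ℝ)), single_dotProduct, single_dotProduct, one_mul, one_mul]
  ring

/-- **`f_{⟨x,x′⟩}`** in plain coordinates: `−η^{D−1}1_{Δ₁}` on `Δ` (face `y_i = n − 1`) and `+η^{D−1}1_{Δ′₁}` on `Δ′`
(face `y_i = 0`) — print: *"f_{⟨x,x′⟩}(y) = Σ_bη^{d−1}(δ^η(y − b₊) − δ^η(y − b₋))"*. [cite: Balaban1983RegularityDecay, (4.21) p.592] -/
def fvec (n : ℕ) [NeZero n] (i : Fin D) : TwoBlk D n → ℝ := Sum.elim (-(faceVec i (top n))) (faceVec i 0)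

/-- `⟨f_{⟨x,x′⟩},φ⟩ = Σ_bη^{d−1}(φ(b₊) − φ(b₋))` (`η^{d−1} = n/n^D`). [cite: Balaban1983RegularityDecay, (4.20)–(4.21) p.592] -/
theorem fvec_dotProduct [NeZero n] (i : Fin D) (φ : TwoBlk D n → ℝ) :
    fvec n i ⬝ᵥ φ = (n : ℝ) / (n : ℝ) ^ D * ∑ y ∈ layer i (top n), (bvec i y ⬝ᵥ φ) := by
  simp_rw [bvec_dotProduct]
  rw [Finset.sum_sub_distrib, sum_across i (fun y' => φ (Sum.inr y')), dotProduct_comm, fvec, dotProduct_sumElim,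
    dotProduct_neg, dotProduct_comm _ (faceVec i (top n)), dotProduct_comm _ (faceVec i 0), faceVec_dotProduct,
    faceVec_dotProduct, faceMean, faceMean]
  ring

/-- the centred bond functional `(∂^ηφ)(b) − Σ_{b′}η^{d−1}(∂^ηφ)(b′)` (times `η`): `cvec y = bvec y − fvec`.
[cite: Balaban1983RegularityDecay, (4.19) p.592] -/
def cvec [NeZero n] (i : Fin D) (y : Blk D n) : TwoBlk D n → ℝ := bvec i y - fvec n i

/-- the block-diagonal part `A_Δ ⊕ A_{Δ′}` of (4.19): `a_k|(Q_kφ)(x)|² + ⟨φ,(−Δ_Δ)φ⟩ + a_k|(Q_kφ)(x′)|² +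
⟨φ,(−Δ_{Δ′})φ⟩` as a matrix. [cite: Balaban1983RegularityDecay, (4.19) p.592] -/
def blockDiag (D n : ℕ) [NeZero n] (a : ℝ) : Matrix (TwoBlk D n) (TwoBlk D n) ℝ :=
  Matrix.fromBlocks (Mform D n a) 0 0 (Mform D n a)

/-- the last term of (4.19), `Σ_bη^d|(∂^ηφ)(b) − Σ_{b′}η^{d−1}(∂^ηφ)(b′)|²`, as a matrix (a sum of rank-one terms).
[cite: Balaban1983RegularityDecay, (4.19) p.592] -/
def varMat (n : ℕ) [NeZero n] (i : Fin D) : Matrix (TwoBlk D n) (TwoBlk D n) ℝ :=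
  Matrix.of fun p q => (n : ℝ) ^ 2 / (n : ℝ) ^ D * ∑ b : ↥(layer i (top n)), cvec i b p * cvec i b q

/-- **THE MATRIX OF THE FORM (4.19)** `⟨φ,Aφ⟩` on the two-block region, in plain coordinates.
[cite: Balaban1983RegularityDecay, (4.19) p.592] -/
def form419 (n : ℕ) [NeZero n] (i : Fin D) (a : ℝ) : Matrix (TwoBlk D n) (TwoBlk D n) ℝ :=
  blockDiag D n a + varMat n i

/-- the block-diagonal part as a quadratic form. [cite: Balaban1983RegularityDecay, (4.19) p.592] -/
theorem dotProduct_blockDiag_mulVec [NeZero n] (a : ℝ) (φ φ' : TwoBlk D n → ℝ) :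
    φ ⬝ᵥ (blockDiag D n a *ᵥ φ')
      = (fun y => φ (Sum.inl y)) ⬝ᵥ (Mform D n a *ᵥ fun y => φ' (Sum.inl y))
        + (fun y => φ (Sum.inr y)) ⬝ᵥ (Mform D n a *ᵥ fun y => φ' (Sum.inr y)) := by
  rw [blockDiag, fromBlocks_mulVec, dotProduct_sumElim]
  simp only [zero_mulVec, add_zero, zero_add]
  rfl

/-- the last term of (4.19) as a bilinear form. [cite: Balaban1983RegularityDecay, (4.19) p.592] -/
theorem dotProduct_varMat_mulVec [NeZero n] (i : Fin D) (φ φ' : TwoBlk D n → ℝ) :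
    φ ⬝ᵥ (varMat n i *ᵥ φ') = (n : ℝ) ^ 2 / (n : ℝ) ^ D *
      ∑ y ∈ layer i (top n), (cvec i y ⬝ᵥ φ) * (cvec i y ⬝ᵥ φ') := by
  rw [dotProduct_mulVec_rankOne 0 ((n : ℝ) ^ 2 / (n : ℝ) ^ D) (fun _ => (0 : ℝ))
    (fun b : ↥(layer i (top n)) => cvec i b) (varMat n i) (fun p q => by simp [varMat]) φ φ',
    Finset.sum_coe_sort (layer i (top n)) (fun y => (cvec i y ⬝ᵥ φ) * (cvec i y ⬝ᵥ φ'))]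
  ring

/-- **(4.19) IS the form of `form419`**: `φ ⬝ form419 φ = qform a φ|_Δ + qform a φ|_{Δ′} +
(n²/n^D)Σ_y(g_y(φ) − (n/n^D)Σ_{y′}g_{y′}(φ))²`, `g_y(φ) = φ(inr (across y)) − φ(inl y)`.
[cite: Balaban1983RegularityDecay, (4.19) p.592] -/
theorem dotProduct_form419_mulVec_self [NeZero n] (i : Fin D) (a : ℝ) (φ : TwoBlk D n → ℝ) :
    φ ⬝ᵥ (form419 n i a *ᵥ φ)
      = qform a (fun y => φ (Sum.inl y)) + qform a (fun y => φ (Sum.inr y))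
        + (n : ℝ) ^ 2 / (n : ℝ) ^ D * ∑ y ∈ layer i (top n),
            ((φ (Sum.inr (across i y)) - φ (Sum.inl y))
              - (n : ℝ) / (n : ℝ) ^ D * ∑ y' ∈ layer i (top n), (φ (Sum.inr (across i y')) - φ (Sum.inl y'))) ^ 2 := by
  rw [form419, add_mulVec, dotProduct_add, dotProduct_blockDiag_mulVec, dotProduct_Mform_mulVec_self,
    dotProduct_Mform_mulVec_self, dotProduct_varMat_mulVec]
  congr 1
  congr 1
  refine Finset.sum_congr rfl (fun y _ => ?_)
  rw [← sq, cvec, sub_dotProduct, fvec_dotProduct, bvec_dotProduct]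
  simp_rw [bvec_dotProduct]

/-- `form419` is symmetric. [cite: Balaban1983RegularityDecay, (4.19) p.592] -/
theorem form419_isHermitian [NeZero n] (i : Fin D) (a : ℝ) : (form419 n i a).IsHermitian := by
  refine Matrix.IsHermitian.ext (fun p q => ?_)
  simp only [star_trivial, form419, Matrix.add_apply, varMat, Matrix.of_apply]
  have hM : (Mform D n a)ᵀ = Mform D n a := by
    have h := (Mform_isHermitian (D := D) (n := n) a).eq
    rwa [conjTranspose_eq_transpose_of_trivial] at h
  have hB : (blockDiag D n a)ᵀ = blockDiag D n a := by
    rw [blockDiag, fromBlocks_transpose, hM, transpose_zero]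
  have hBpq : blockDiag D n a q p = blockDiag D n a p q := by
    rw [← transpose_apply (blockDiag D n a) p q, hB]
  rw [hBpq]
  congr 1
  congr 1
  exact Finset.sum_congr rfl (fun b _ => mul_comm _ _)

/-- the block-diagonal part is symmetric. [cite: Balaban1983RegularityDecay, (4.19) p.592] -/
theorem blockDiag_isHermitian [NeZero n] (a : ℝ) : (blockDiag D n a).IsHermitian := by
  have hM : (Mform D n a)ᵀ = Mform D n a := by
    have h := (Mform_isHermitian (D := D) (n := n) a).eq
    rwa [conjTranspose_eq_transpose_of_trivial] at h
  show (blockDiag D n a)ᴴ = blockDiag D n a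
  rw [conjTranspose_eq_transpose_of_trivial, blockDiag, fromBlocks_transpose, hM, transpose_zero]

/-- the block-diagonal part `A_Δ ⊕ A_{Δ′}` is positive definite for `a > 0`. [cite: Balaban1983RegularityDecay, (4.19) p.592] -/
theorem blockDiag_posDef [NeZero n] {a : ℝ} (ha : 0 < a) : (blockDiag D n a).PosDef := by
  refine Matrix.PosDef.of_dotProduct_mulVec_pos (blockDiag_isHermitian a) (fun φ hφ => ?_)
  simp only [star_trivial]
  rw [dotProduct_blockDiag_mulVec]
  by_cases h1 : (fun y => φ (Sum.inl y)) = 0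
  · have h2 : (fun y => φ (Sum.inr y)) ≠ 0 := by
      intro h2
      apply hφ
      funext p
      rcases p with y | y
      · exact congrFun h1 y
      · exact congrFun h2 y
    rw [h1, zero_dotProduct, zero_add]
    exact Mform_pos ha h2
  · have := Mform_pos ha h1
    have h0 : 0 ≤ (fun y => φ (Sum.inr y)) ⬝ᵥ (Mform D n a *ᵥ fun y => φ (Sum.inr y)) := by
      rw [dotProduct_Mform_mulVec_self]; exact qform_nonneg ha.le _
    linarith

/-- the last term of (4.19) is positive semidefinite. [cite: Balaban1983RegularityDecay, (4.19) p.592] -/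
theorem varMat_posSemidef [NeZero n] (i : Fin D) : (varMat n i).PosSemidef := by
  refine Matrix.PosSemidef.of_dotProduct_mulVec_nonneg ?_ (fun φ => ?_)
  · refine Matrix.IsHermitian.ext (fun p q => ?_)
    simp only [star_trivial, varMat, Matrix.of_apply]
    congr 1
    exact Finset.sum_congr rfl (fun b _ => mul_comm _ _)
  · simp only [star_trivial]
    rw [dotProduct_varMat_mulVec]
    refine mul_nonneg (by positivity) (Finset.sum_nonneg fun y _ => ?_)
    rw [← sq]; exact sq_nonneg _

/-- **the form (4.19) is positive definite** (`a > 0`). [cite: Balaban1983RegularityDecay, (4.19) p.592] -/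
theorem form419_posDef [NeZero n] (i : Fin D) {a : ℝ} (ha : 0 < a) : (form419 n i a).PosDef :=
  (blockDiag_posDef ha).add_posSemidef (varMat_posSemidef i)

/-! ## §4. (4.16) and (4.21) in the block model -/

/-- **the constant `A₀` of (4.16)/(4.21)**: `A₀ = (η + ⟨f_{⟨x,x′⟩},A⁻¹f_{⟨x,x′⟩}⟩)⁻¹`, `η = n⁻¹`.
[cite: Balaban1983RegularityDecay, (4.16), (4.21) p.592] -/
def A0 (n : ℕ) [NeZero n] (i : Fin D) (a : ℝ) : ℝ :=
  ((n : ℝ)⁻¹ + fvec n i ⬝ᵥ ((form419 n i a)⁻¹ *ᵥ fvec n i))⁻¹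

/-- **(4.21)** *"A₀^{−1} = η + ⟨f_{⟨x,x′⟩}, A^{−1}f_{⟨x,x′⟩}⟩"* (`η = n⁻¹`). [cite: Balaban1983RegularityDecay, (4.21) p.592] -/
theorem eq421_twoBlock [NeZero n] (i : Fin D) (a : ℝ) :
    (A0 n i a)⁻¹ = (n : ℝ)⁻¹ + fvec n i ⬝ᵥ ((form419 n i a)⁻¹ *ᵥ fvec n i) := by
  rw [A0, inv_inv]

/-- the exponent of (4.16) rewritten by (4.18)–(4.19): `−½qform(φ|_Δ) − ½qform(φ|_{Δ′}) − ½η^{d−2}Σ_b(g_b + ψ)² =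
−½η⁻¹(ψ + ⟨f,φ⟩)² − ½φ⬝form419 φ`. [cite: Balaban1983RegularityDecay, (4.18)–(4.19) p.592] -/
theorem exponent416_eq [NeZero n] (i : Fin D) (a : ℝ) (ψ : ℝ) (φ : TwoBlk D n → ℝ) :
    -(1 / 2) * qform a (fun y => φ (Sum.inl y)) - 1 / 2 * qform a (fun y => φ (Sum.inr y))
        - 1 / 2 * ((n : ℝ) ^ 2 / (n : ℝ) ^ D *
            ∑ y ∈ layer i (top n), (φ (Sum.inr (across i y)) - φ (Sum.inl y) + ψ) ^ 2)
      = -(1 / 2) * ((n : ℝ) * (ψ + fvec n i ⬝ᵥ φ) ^ 2) - 1 / 2 * (φ ⬝ᵥ (form419 n i a *ᵥ φ)) := by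
  rw [dotProduct_form419_mulVec_self, fvec_dotProduct]
  simp_rw [bvec_dotProduct]
  have h418 := eq418_twoBlock i (fun y => φ (Sum.inr (across i y)) - φ (Sum.inl y)) ψ
  simp only at h418
  linarith

/-- **(4.16) in the block model, with (4.21)**: *"∫dφ|_{Δ(x,x′)} exp[−½a_k|(Q_kφ)(x)|² − ½⟨φ,(−Δ^{η,N}_Δ)φ⟩ −
½a_k|(Q_kφ)(x′)|² − ½⟨φ,(−Δ^{η,N}_{Δ′})φ⟩ − ½Σ_{b∈B(⟨x,x′⟩)}η^d|(∂^ηφ)(b) + η^{−1}ψ|²] = const exp(−½A₀|ψ|²)"*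
with `A₀ = A0 n i a = (η + ⟨f,A⁻¹f⟩)⁻¹` and `const = ∫dφ e^{−½φ⬝(form419 + η⁻¹f fᵀ)φ}`; by (4.18) (`exponent416_eq`)
and the abstract Gaussian computation `B4Eq417GaussFourier.eq416`. [cite: Balaban1983RegularityDecay, (4.16), (4.21) p.592] -/
theorem eq416_twoBlock [NeZero n] (i : Fin D) {a : ℝ} (ha : 0 < a) (ψ : ℝ) :
    ∫ φ : TwoBlk D n → ℝ, Real.exp (-(1 / 2) * qform a (fun y => φ (Sum.inl y))
        - 1 / 2 * qform a (fun y => φ (Sum.inr y))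
        - 1 / 2 * ((n : ℝ) ^ 2 / (n : ℝ) ^ D *
            ∑ y ∈ layer i (top n), (φ (Sum.inr (across i y)) - φ (Sum.inl y) + ψ) ^ 2))
      = gaussNorm (form419 n i a + (n : ℝ) • vecMulVec (fvec n i) (fvec n i))
          * Real.exp (-(1 / 2) * (A0 n i a * ψ ^ 2)) := by
  have hn : (0 : ℝ) < n := by exact_mod_cast NeZero.pos n
  simp_rw [exponent416_eq i a ψ]
  rw [eq416 (form419_posDef i ha) hn (fvec n i) ψ, A0]

/-! ## §5. (4.22): `⟨f,A⁻¹f⟩ ≤ ⟨f,G_k(Δ)f⟩ + ⟨f,G_k(Δ′)f⟩`, hence `A₀ ≥ γ₀″` -/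

/-- symmetry of the pairing with a symmetric matrix. [folklore] -/
private theorem dotProduct_mulVec_comm_of_symm {m : Type*} [Fintype m] {A : Matrix m m ℝ} (hA : Aᵀ = A)
    (u v : m → ℝ) : u ⬝ᵥ (A *ᵥ v) = v ⬝ᵥ (A *ᵥ u) := by
  rw [dotProduct_mulVec, ← mulVec_transpose, hA, dotProduct_comm]

/-- Löwner monotonicity of the inverse: `A > 0`, `P ≥ 0` ⇒ `⟨x,(A+P)⁻¹x⟩ ≤ ⟨x,A⁻¹x⟩` (the step *"From (4.19) and
the definition of f it follows that ⟨f,A^{−1}f⟩ ≤ ⟨f,G_k(Δ)f⟩ + ⟨f,G_k(Δ′)f⟩"*: drop the last, nonnegative, term of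
(4.19)). [folklore] -/
private theorem inv_form_le_of_posSemidef {m : Type*} [Fintype m] [DecidableEq m] {A P : Matrix m m ℝ}
    (hA : A.PosDef) (hP : P.PosSemidef) (x : m → ℝ) :
    x ⬝ᵥ ((A + P)⁻¹ *ᵥ x) ≤ x ⬝ᵥ (A⁻¹ *ᵥ x) := by
  have hB : (A + P).PosDef := hA.add_posSemidef hP
  have hdetA : IsUnit A.det := isUnit_iff_ne_zero.2 hA.det_pos.ne'
  have hdetB : IsUnit (A + P).det := isUnit_iff_ne_zero.2 hB.det_pos.ne'
  have hAs : Aᵀ = A := by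
    have h := hA.isHermitian.eq
    rwa [conjTranspose_eq_transpose_of_trivial] at h
  set y := (A + P)⁻¹ *ᵥ x with hy
  set z := A⁻¹ *ᵥ x with hz
  have hBy : (A + P) *ᵥ y = x := by rw [hy, mulVec_mulVec, mul_nonsing_inv _ hdetB, one_mulVec]
  have hAz : A *ᵥ z = x := by rw [hz, mulVec_mulVec, mul_nonsing_inv _ hdetA, one_mulVec]
  have h1 : x ⬝ᵥ y = y ⬝ᵥ (A *ᵥ y) + y ⬝ᵥ (P *ᵥ y) := by
    conv_lhs => rw [← hBy]
    rw [add_mulVec, add_dotProduct, dotProduct_comm (A *ᵥ y) y, dotProduct_comm (P *ᵥ y) y]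
  have hPy : 0 ≤ y ⬝ᵥ (P *ᵥ y) := by
    simpa only [star_trivial] using hP.dotProduct_mulVec_nonneg y
  have h2 : 0 ≤ (z - y) ⬝ᵥ (A *ᵥ (z - y)) := by
    simpa only [star_trivial] using hA.posSemidef.dotProduct_mulVec_nonneg (z - y)
  have h3 : (z - y) ⬝ᵥ (A *ᵥ (z - y)) = x ⬝ᵥ z - 2 * (x ⬝ᵥ y) + y ⬝ᵥ (A *ᵥ y) := by
    rw [mulVec_sub, sub_dotProduct, dotProduct_sub, dotProduct_sub, hAz, dotProduct_mulVec_comm_of_symm hAs z y,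
      hAz, dotProduct_comm z x, dotProduct_comm y x]
    ring
  linarith

/-- the Green's function of the decoupled blocks: `(A_Δ ⊕ A_{Δ′})⁻¹ = G_k(Δ) ⊕ G_k(Δ′)`.
[cite: Balaban1983RegularityDecay, (4.22) p.593] -/
theorem blockDiag_inv [NeZero n] (a : ℝ) :
    (blockDiag D n a)⁻¹ = Matrix.fromBlocks (Mform D n a)⁻¹ 0 0 (Mform D n a)⁻¹ := by
  rw [blockDiag, inv_fromBlocks_zero₂₁_of_isUnit_iff _ _ _ Iff.rfl]
  simp

/-- *"⟨f_{⟨x,x′⟩},G_k(Δ)f_{⟨x,x′⟩}⟩ + ⟨f_{⟨x,x′⟩},G_k(Δ′)f_{⟨x,x′⟩}⟩"*: the pairing of `f` with the decoupled Green's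
function splits into the two face functionals. [cite: Balaban1983RegularityDecay, (4.22) p.593] -/
theorem fvec_blockDiag_inv [NeZero n] (i : Fin D) (a : ℝ) :
    fvec n i ⬝ᵥ ((blockDiag D n a)⁻¹ *ᵥ fvec n i)
      = faceVec i (top n) ⬝ᵥ ((Mform D n a)⁻¹ *ᵥ faceVec i (top n))
        + faceVec i 0 ⬝ᵥ ((Mform D n a)⁻¹ *ᵥ faceVec i 0) := by
  rw [blockDiag_inv, fromBlocks_mulVec, dotProduct_sumElim]
  simp only [zero_mulVec, add_zero, zero_add, neg_zero, fvec, Sum.elim_comp_inl, Sum.elim_comp_inr, Sum.elim_inl,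
    Sum.elim_inr, mulVec_neg, dotProduct_neg, Pi.neg_apply]
  have e1 : (fun y : Blk D n => -faceVec i (top n) y) = -faceVec i (top n) := rfl
  have e2 : (fun y : Blk D n => faceVec i 0 y) = faceVec i 0 := rfl
  rw [e1, e2, neg_dotProduct, neg_neg]

/-- **(4.22), the inequality** *"⟨f_{⟨x,x′⟩}, A^{−1}f_{⟨x,x′⟩}⟩ ≤ ⟨f_{⟨x,x′⟩}, G_k(Δ)f_{⟨x,x′⟩}⟩ + ⟨f_{⟨x,x′⟩},
G_k(Δ′)f_{⟨x,x′⟩}⟩"* — *"From (4.19) and the definition of f_{⟨x,x′⟩} it follows"*: `A ≥ A_Δ ⊕ A_{Δ′}` (the last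
term of (4.19) is nonnegative), Löwner monotonicity of the inverse, and the block-diagonal Green's function.
[cite: Balaban1983RegularityDecay, (4.22) p.593] -/
theorem ineq422_twoBlock [NeZero n] (i : Fin D) {a : ℝ} (ha : 0 < a) :
    fvec n i ⬝ᵥ ((form419 n i a)⁻¹ *ᵥ fvec n i)
      ≤ faceVec i (top n) ⬝ᵥ ((Mform D n a)⁻¹ *ᵥ faceVec i (top n))
        + faceVec i 0 ⬝ᵥ ((Mform D n a)⁻¹ *ᵥ faceVec i 0) := by
  rw [← fvec_blockDiag_inv, form419]
  exact inv_form_le_of_posSemidef (blockDiag_posDef ha) (varMat_posSemidef i) _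

/-- **(4.22) with the cell's uniform bound**: each face term is `η^{2(d−1)}Σ_{y,y′∈Δ₁}G_k(Δ;y,y′) ≤ 2max{1,a⁻¹}`
(`B4Ineq422.faceVec_dotProduct_mulVec`, `B4Ineq422.ineq422`, for the face `y_i = n − 1` of `Δ` and the face `y_i = 0`
of `Δ′`), so `⟨f,A⁻¹f⟩ ≤ 4max{1,a⁻¹}` — *"the expression on the right side of (4.22) is a constant γ₀″^{−1}"*.
[cite: Balaban1983RegularityDecay, (4.22) p.593] -/
theorem fAf_le [NeZero n] (i : Fin D) {a : ℝ} (ha : 0 < a) :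
    fvec n i ⬝ᵥ ((form419 n i a)⁻¹ *ᵥ fvec n i) ≤ 4 * max 1 a⁻¹ := by
  have h := ineq422_twoBlock (n := n) i ha
  rw [faceVec_dotProduct_mulVec, faceVec_dotProduct_mulVec] at h
  have h1 := ineq422 ha i (top n)
  have h2 := ineq422 ha i (0 : Fin n)
  linarith

/-- *"Of course both terms on the right side of (4.21) are ≧ 0"*: `⟨f,A⁻¹f⟩ ≥ 0`. [cite: Balaban1983RegularityDecay, p.592 (after (4.21))] -/
theorem fAf_nonneg [NeZero n] (i : Fin D) {a : ℝ} (ha : 0 < a) :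
    0 ≤ fvec n i ⬝ᵥ ((form419 n i a)⁻¹ *ᵥ fvec n i) := by
  simpa only [star_trivial] using (form419_posDef i ha).posSemidef.inv.dotProduct_mulVec_nonneg (fvec n i)

/-- `A₀ > 0`. [cite: Balaban1983RegularityDecay, p.592 (after (4.16))] -/
theorem A0_pos [NeZero n] (i : Fin D) {a : ℝ} (ha : 0 < a) : 0 < A0 n i a := by
  have hn : (0 : ℝ) < n := by exact_mod_cast NeZero.pos n
  have := fAf_nonneg (n := n) i ha
  exact inv_pos.2 (by positivity)

/-- **`A₀⁻¹ ≤ γ₀″⁻¹ := 1 + 4max{1,a⁻¹}`** — *"Now it is sufficient to prove that 0 < A₀^{−1} ≤ γ₀″^{−1}, and γ₀″^{−1}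
depends on d and a only"*: (4.21) + (4.22) + the cell's certificate `B4Ineq422.ineq422` + `η = n⁻¹ ≤ 1`; the
constant is that of `B4Ineq422.gamma0_inv_le`, uniform in `η` and (a by-product) in `d`.
[cite: Balaban1983RegularityDecay, (4.21)–(4.22) pp.592–593] -/
theorem A0_inv_le [NeZero n] (i : Fin D) {a : ℝ} (ha : 0 < a) : (A0 n i a)⁻¹ ≤ 1 + 4 * max 1 a⁻¹ := by
  rw [eq421_twoBlock]
  have h1 : (n : ℝ)⁻¹ ≤ 1 := inv_le_one_of_one_le₀ (by exact_mod_cast NeZero.one_le)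
  have h2 := fAf_le (n := n) i ha
  linarith

/-- **`A₀ ≥ γ₀″ > 0`** — *"we have to show that A₀ > 0, more exactly A₀ ≥ γ₀″, γ₀″ > 0, and γ₀″ depends on d and a
only"*, with `γ₀″ = (1 + 4max{1,a⁻¹})⁻¹`. [cite: Balaban1983RegularityDecay, p.592 (after (4.16)), (4.22) p.593] -/
theorem gamma0''_le_A0 [NeZero n] (i : Fin D) {a : ℝ} (ha : 0 < a) : (1 + 4 * max 1 a⁻¹)⁻¹ ≤ A0 n i a := by
  have h := A0_inv_le (n := n) i ha
  have hA := A0_pos (n := n) i ha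
  rw [← inv_inv (A0 n i a)]
  exact inv_anti₀ (inv_pos.2 hA) h

/-- `γ₀″ > 0`. [cite: Balaban1983RegularityDecay, p.592] -/
theorem gamma0''_pos (a : ℝ) : 0 < (1 + 4 * max 1 a⁻¹ : ℝ)⁻¹ := by
  have : (1 : ℝ) ≤ max 1 a⁻¹ := le_max_left _ _
  exact inv_pos.2 (by linarith)

/-! ## §6. (4.15) = (4.16) by the translations of p. 591, and *"Thus the inequality (4.14) is proved"*:
in the block model the left side of (4.14) IS `A₀|φ″(x′) − φ″(x)|²` -/

/-- the row of `Q_k^*` at `x`: `w0L ⬝ φ = (Q_kφ)(x) = mean φ|_Δ`. [cite: Balaban1983RegularityDecay, (4.14)–(4.15) p.591] -/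
def w0L (D n : ℕ) : TwoBlk D n → ℝ := Sum.elim (w0 D n) 0

/-- the row of `Q_k^*` at `x′`: `w0R ⬝ φ = (Q_kφ)(x′) = mean φ|_{Δ′}`. [cite: Balaban1983RegularityDecay, (4.14)–(4.15) p.591] -/
def w0R (D n : ℕ) : TwoBlk D n → ℝ := Sum.elim 0 (w0 D n)

/-- `w0L ⬝ φ = mean φ|_Δ`. [cite: Balaban1983RegularityDecay, (4.15) p.591] -/
theorem w0L_dotProduct (φ : TwoBlk D n → ℝ) : w0L D n ⬝ᵥ φ = mean (fun y => φ (Sum.inl y)) := by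
  rw [dotProduct_comm, w0L, dotProduct_sumElim, dotProduct_zero, add_zero, dotProduct_comm, w0_dotProduct]

/-- `w0R ⬝ φ = mean φ|_{Δ′}`. [cite: Balaban1983RegularityDecay, (4.15) p.591] -/
theorem w0R_dotProduct (φ : TwoBlk D n → ℝ) : w0R D n ⬝ᵥ φ = mean (fun y => φ (Sum.inr y)) := by
  rw [dotProduct_comm, w0R, dotProduct_sumElim, dotProduct_zero, zero_add, dotProduct_comm, w0_dotProduct]

/-- `Q_k^*φ″` for `φ″ = (φ″(x), φ″(x′)) = (ψ₁, ψ₂)`, in plain coordinates. [cite: Balaban1983RegularityDecay, (4.14) p.591] -/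
def qvec (D n : ℕ) (ψ₁ ψ₂ : ℝ) : TwoBlk D n → ℝ := ψ₁ • w0L D n + ψ₂ • w0R D n

/-- `Q_k^*φ″ ⬝ φ = ψ₁·mean φ|_Δ + ψ₂·mean φ|_{Δ′}`. [cite: Balaban1983RegularityDecay, (4.14)–(4.15) p.591] -/
theorem qvec_dotProduct (ψ₁ ψ₂ : ℝ) (φ : TwoBlk D n → ℝ) :
    qvec D n ψ₁ ψ₂ ⬝ᵥ φ = ψ₁ * mean (fun y => φ (Sum.inl y)) + ψ₂ * mean (fun y => φ (Sum.inr y)) := by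
  rw [qvec, add_dotProduct, smul_dotProduct, smul_dotProduct, w0L_dotProduct, w0R_dotProduct, smul_eq_mul,
    smul_eq_mul]

/-- the connecting bonds `B(⟨x,x′⟩)` of the Neumann Laplacian `−Δ^{η,N}_{Δ(x,x′)}` of the two-block region, as a matrix
(`η^{D−2}Σ_{b∈B(⟨x,x′⟩)}`, rank-one terms). [cite: Balaban1983RegularityDecay, (4.15)–(4.16) pp.591–592] -/
def bondMat (n : ℕ) [NeZero n] (i : Fin D) : Matrix (TwoBlk D n) (TwoBlk D n) ℝ :=
  Matrix.of fun p q => (n : ℝ) ^ 2 / (n : ℝ) ^ D * ∑ b : ↥(layer i (top n)), bvec i b p * bvec i b q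

/-- `a_kQ_k^*Q_k + (−Δ^{η,N}_{Δ(x,x′)})` on the two-block region in plain coordinates — the matrix whose inverse is the
block-model Green's function `G_k(Δ(x,x′),0)` (as `Mform D n a` is for one block in `B4Ineq422`).
[cite: Balaban1983RegularityDecay, (4.14)–(4.15) p.591, (1.6) p.572] -/
def Kform (n : ℕ) [NeZero n] (i : Fin D) (a : ℝ) : Matrix (TwoBlk D n) (TwoBlk D n) ℝ :=
  blockDiag D n a + bondMat n i

/-- the connecting-bond matrix as a bilinear form. [cite: Balaban1983RegularityDecay, (4.16) p.592] -/
theorem dotProduct_bondMat_mulVec [NeZero n] (i : Fin D) (φ φ' : TwoBlk D n → ℝ) :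
    φ ⬝ᵥ (bondMat n i *ᵥ φ') = (n : ℝ) ^ 2 / (n : ℝ) ^ D *
      ∑ y ∈ layer i (top n), (bvec i y ⬝ᵥ φ) * (bvec i y ⬝ᵥ φ') := by
  rw [dotProduct_mulVec_rankOne 0 ((n : ℝ) ^ 2 / (n : ℝ) ^ D) (fun _ => (0 : ℝ))
    (fun b : ↥(layer i (top n)) => bvec i b) (bondMat n i) (fun p q => by simp [bondMat]) φ φ',
    Finset.sum_coe_sort (layer i (top n)) (fun y => (bvec i y ⬝ᵥ φ) * (bvec i y ⬝ᵥ φ'))]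
  ring

/-- the quadratic form of `Kform`: `a_k|(Q_kφ)(x)|² + a_k|(Q_kφ)(x′)|² + ⟨φ,(−Δ^{η,N}_{Δ(x,x′)})φ⟩ = qform a φ|_Δ +
qform a φ|_{Δ′} + η^{D−2}Σ_{b∈B(⟨x,x′⟩)}(φ(b₊) − φ(b₋))²`. [cite: Balaban1983RegularityDecay, (4.15) p.591] -/
theorem dotProduct_Kform_mulVec_self [NeZero n] (i : Fin D) (a : ℝ) (φ : TwoBlk D n → ℝ) :
    φ ⬝ᵥ (Kform n i a *ᵥ φ)
      = qform a (fun y => φ (Sum.inl y)) + qform a (fun y => φ (Sum.inr y))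
        + (n : ℝ) ^ 2 / (n : ℝ) ^ D * ∑ y ∈ layer i (top n), (φ (Sum.inr (across i y)) - φ (Sum.inl y)) ^ 2 := by
  rw [Kform, add_mulVec, dotProduct_add, dotProduct_blockDiag_mulVec, dotProduct_Mform_mulVec_self,
    dotProduct_Mform_mulVec_self, dotProduct_bondMat_mulVec]
  simp_rw [bvec_dotProduct, ← sq]

/-- `Kform` is symmetric. [cite: Balaban1983RegularityDecay, (4.15) p.591] -/
theorem Kform_isHermitian [NeZero n] (i : Fin D) (a : ℝ) : (Kform n i a).IsHermitian := by
  refine Matrix.IsHermitian.ext (fun p q => ?_)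
  have hB := (blockDiag_isHermitian (D := D) (n := n) a).apply p q
  simp only [star_trivial] at hB ⊢
  simp only [Kform, Matrix.add_apply, bondMat, Matrix.of_apply]
  rw [hB]
  congr 1
  congr 1
  exact Finset.sum_congr rfl (fun b _ => mul_comm _ _)

/-- `Kform` is positive definite for `a > 0` (so the two-block Green's function exists).
[cite: Balaban1983RegularityDecay, (4.15) p.591] -/
theorem Kform_posDef [NeZero n] (i : Fin D) {a : ℝ} (ha : 0 < a) : (Kform n i a).PosDef := by
  refine (blockDiag_posDef ha).add_posSemidef ?_
  refine Matrix.PosSemidef.of_dotProduct_mulVec_nonneg ?_ (fun φ => ?_)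
  · refine Matrix.IsHermitian.ext (fun p q => ?_)
    simp only [star_trivial, bondMat, Matrix.of_apply]
    congr 1
    exact Finset.sum_congr rfl (fun b _ => mul_comm _ _)
  · simp only [star_trivial]
    rw [dotProduct_bondMat_mulVec]
    refine mul_nonneg (by positivity) (Finset.sum_nonneg fun y _ => ?_)
    rw [← sq]; exact sq_nonneg _

/-- **the left side of (4.14) in the block model**: `a_k|φ″(x)|² + a_k|φ″(x′)|² − a_k²⟨φ″, Q_kG_k(Δ(x,x′),0)Q_k^*φ″⟩`
with `φ″ = (ψ₁,ψ₂)`, `G_k(Δ(x,x′),0) = Kform⁻¹`. [cite: Balaban1983RegularityDecay, (4.14) p.591] -/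
def lhs414 (n : ℕ) [NeZero n] (i : Fin D) (a ψ₁ ψ₂ : ℝ) : ℝ :=
  a * (ψ₁ ^ 2 + ψ₂ ^ 2) - a ^ 2 * (qvec D n ψ₁ ψ₂ ⬝ᵥ ((Kform n i a)⁻¹ *ᵥ qvec D n ψ₁ ψ₂))

/-- **(4.15)** in the block model — *"We use again the fact that const. exp[−½(the left side of (4.14))] is equal to
the integral ∫dφ′|_{Δ(x,x′)} exp[−½a_k|φ″(x) − (Q_kφ′)(x)|² − ½a_k|φ″(x′) − (Q_kφ′)(x′)|² − ½⟨φ′,(−Δ^{η,N}_{Δ(x,x′)})φ′⟩]"*,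
with `const = ∫dφ e^{−½φ⬝Kform φ}` (completing the square, `B2Eq228Conditioning.integral_tilt`; the abstract statement
is `B4Eq415Gaussian.eq415`). [cite: Balaban1983RegularityDecay, (4.15) p.591] -/
theorem eq415_twoBlock [NeZero n] (i : Fin D) {a : ℝ} (ha : 0 < a) (ψ₁ ψ₂ : ℝ) :
    ∫ φ : TwoBlk D n → ℝ, Real.exp (-(1 / 2) * (a * (ψ₁ - mean (fun y => φ (Sum.inl y))) ^ 2)
        - 1 / 2 * (a * (ψ₂ - mean (fun y => φ (Sum.inr y))) ^ 2)
        - 1 / 2 * ((n : ℝ) ^ 2 / (n : ℝ) ^ D * (dirichlet (fun y => φ (Sum.inl y))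
            + dirichlet (fun y => φ (Sum.inr y))
            + ∑ y ∈ layer i (top n), (φ (Sum.inr (across i y)) - φ (Sum.inl y)) ^ 2)))
      = gaussNorm (Kform n i a) * Real.exp (-(1 / 2) * lhs414 n i a ψ₁ ψ₂) := by
  set K := Kform n i a with hK
  have hKpd : K.PosDef := Kform_posDef i ha
  have hKs : K.IsSymm := by
    have h := hKpd.isHermitian.eq
    rwa [conjTranspose_eq_transpose_of_trivial] at h
  have hKdet : IsUnit K.det := isUnit_iff_ne_zero.2 hKpd.det_pos.ne'
  set j : TwoBlk D n → ℝ := (-a) • qvec D n ψ₁ ψ₂ with hj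
  have hpt : ∀ φ : TwoBlk D n → ℝ,
      Real.exp (-(1 / 2) * (a * (ψ₁ - mean (fun y => φ (Sum.inl y))) ^ 2)
        - 1 / 2 * (a * (ψ₂ - mean (fun y => φ (Sum.inr y))) ^ 2)
        - 1 / 2 * ((n : ℝ) ^ 2 / (n : ℝ) ^ D * (dirichlet (fun y => φ (Sum.inl y))
            + dirichlet (fun y => φ (Sum.inr y))
            + ∑ y ∈ layer i (top n), (φ (Sum.inr (across i y)) - φ (Sum.inl y)) ^ 2)))
      = Real.exp (-(1 / 2) * (a * (ψ₁ ^ 2 + ψ₂ ^ 2))) *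
        (Real.exp (-(j ⬝ᵥ φ) - 1 / 2 * (φ ⬝ᵥ (K *ᵥ φ))) * (1 : ℝ)) := by
    intro φ
    rw [mul_one, ← Real.exp_add]
    congr 1
    rw [hK, dotProduct_Kform_mulVec_self, hj, smul_dotProduct, qvec_dotProduct, smul_eq_mul, qform, qform]
    ring
  simp_rw [hpt]
  rw [integral_const_mul, B2Eq228Conditioning.integral_tilt K hKs hKdet j (fun _ => (1 : ℝ))]
  have hg : gaussInt K (fun _ : TwoBlk D n → ℝ => (1 : ℝ)) = gaussNorm K := by
    simp [gaussInt, gaussNorm]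
  rw [hg, lhs414, ← hK, hj, smul_dotProduct, mulVec_smul, dotProduct_smul, smul_eq_mul, smul_eq_mul]
  rw [show Real.exp (-(1 / 2) * (a * (ψ₁ ^ 2 + ψ₂ ^ 2))) *
      (Real.exp (1 / 2 * (-a * (-a * (qvec D n ψ₁ ψ₂ ⬝ᵥ (K⁻¹ *ᵥ qvec D n ψ₁ ψ₂))))) * gaussNorm K)
      = gaussNorm K * (Real.exp (-(1 / 2) * (a * (ψ₁ ^ 2 + ψ₂ ^ 2))) *
        Real.exp (1 / 2 * (-a * (-a * (qvec D n ψ₁ ψ₂ ⬝ᵥ (K⁻¹ *ᵥ qvec D n ψ₁ ψ₂)))))) by ring, ← Real.exp_add]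
  congr 2
  ring

/-- the block mean is affine: `mean(φ + c) = mean φ + c`. [folklore] -/
private theorem mean_add_const [NeZero n] (g : Blk D n → ℝ) (c : ℝ) : mean (fun y => g y + c) = mean g + c := by
  have hn : (n : ℝ) ^ D ≠ 0 := pow_ne_zero _ (by exact_mod_cast NeZero.ne n)
  simp only [mean, Finset.sum_add_distrib, Finset.sum_const, Finset.card_univ, Fintype.card_pi, Fintype.card_fin,
    Finset.prod_const, nsmul_eq_mul]
  push_cast
  field_simp

/-- the Dirichlet form is translation invariant: `dirichlet(φ + c) = dirichlet φ`. [folklore] -/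
private theorem dirichlet_add_const [NeZero n] (g : Blk D n → ℝ) (c : ℝ) :
    dirichlet (fun y => g y + c) = dirichlet g := by
  simp [dirichlet]

/-- the translations of p. 591: `φ′ = φ + φ″(x)` on `Δ`, `φ′ = φ + φ″(x′)` on `Δ′`. [cite: Balaban1983RegularityDecay, p.591 (before (4.16))] -/
def shiftVec (D n : ℕ) (ψ₁ ψ₂ : ℝ) : TwoBlk D n → ℝ := Sum.elim (fun _ => ψ₁) (fun _ => ψ₂)

/-- **(4.15) becomes (4.16) under the translations** *"φ′(y) = φ(y) + φ″(x) for y ∈ Δ, φ′(y) = φ(y) + φ″(x′)* [printed: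
`φ″(x)`] *for y ∈ Δ′"*, with `ψ = φ″(x′) − φ″(x) = ψ₂ − ψ₁`: the integrand of (4.15) at `φ + shiftVec` is the integrand
of (4.16) at `φ`. [cite: Balaban1983RegularityDecay, p.591–592, (4.15)–(4.16)] -/
theorem integrand415_shift [NeZero n] (i : Fin D) (a ψ₁ ψ₂ : ℝ) (φ : TwoBlk D n → ℝ) :
    -(1 / 2) * (a * (ψ₁ - mean (fun y => (φ + shiftVec D n ψ₁ ψ₂) (Sum.inl y))) ^ 2)
        - 1 / 2 * (a * (ψ₂ - mean (fun y => (φ + shiftVec D n ψ₁ ψ₂) (Sum.inr y))) ^ 2)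
        - 1 / 2 * ((n : ℝ) ^ 2 / (n : ℝ) ^ D * (dirichlet (fun y => (φ + shiftVec D n ψ₁ ψ₂) (Sum.inl y))
            + dirichlet (fun y => (φ + shiftVec D n ψ₁ ψ₂) (Sum.inr y))
            + ∑ y ∈ layer i (top n),
                ((φ + shiftVec D n ψ₁ ψ₂) (Sum.inr (across i y)) - (φ + shiftVec D n ψ₁ ψ₂) (Sum.inl y)) ^ 2))
      = -(1 / 2) * qform a (fun y => φ (Sum.inl y)) - 1 / 2 * qform a (fun y => φ (Sum.inr y))
        - 1 / 2 * ((n : ℝ) ^ 2 / (n : ℝ) ^ D *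
            ∑ y ∈ layer i (top n), (φ (Sum.inr (across i y)) - φ (Sum.inl y) + (ψ₂ - ψ₁)) ^ 2) := by
  simp only [Pi.add_apply, shiftVec, Sum.elim_inl, Sum.elim_inr, mean_add_const, dirichlet_add_const, qform]
  have e : ∀ y : Blk D n, (φ (Sum.inr (across i y)) + ψ₂ - (φ (Sum.inl y) + ψ₁)) ^ 2
      = (φ (Sum.inr (across i y)) - φ (Sum.inl y) + (ψ₂ - ψ₁)) ^ 2 := fun y => by ring
  simp_rw [e]
  ring

/-- **the integral of (4.15) equals the integral of (4.16)** at `ψ = ψ₂ − ψ₁` (translation invariance of `dφ`).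
[cite: Balaban1983RegularityDecay, p.591–592, (4.15)–(4.16)] -/
theorem integral415_eq_integral416 [NeZero n] (i : Fin D) (a ψ₁ ψ₂ : ℝ) :
    ∫ φ : TwoBlk D n → ℝ, Real.exp (-(1 / 2) * (a * (ψ₁ - mean (fun y => φ (Sum.inl y))) ^ 2)
        - 1 / 2 * (a * (ψ₂ - mean (fun y => φ (Sum.inr y))) ^ 2)
        - 1 / 2 * ((n : ℝ) ^ 2 / (n : ℝ) ^ D * (dirichlet (fun y => φ (Sum.inl y))
            + dirichlet (fun y => φ (Sum.inr y))
            + ∑ y ∈ layer i (top n), (φ (Sum.inr (across i y)) - φ (Sum.inl y)) ^ 2)))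
      = ∫ φ : TwoBlk D n → ℝ, Real.exp (-(1 / 2) * qform a (fun y => φ (Sum.inl y))
        - 1 / 2 * qform a (fun y => φ (Sum.inr y))
        - 1 / 2 * ((n : ℝ) ^ 2 / (n : ℝ) ^ D *
            ∑ y ∈ layer i (top n), (φ (Sum.inr (across i y)) - φ (Sum.inl y) + (ψ₂ - ψ₁)) ^ 2)) := by
  rw [← integral_add_right_eq_self _ (shiftVec D n ψ₁ ψ₂)]
  refine integral_congr_ae (Filter.Eventually.of_forall fun φ => ?_)
  simp only
  rw [integrand415_shift]

/-- the two normalising constants agree: `∫dφ e^{−½φ⬝Kform φ} = ∫dφ e^{−½φ⬝(form419 + η⁻¹f fᵀ)φ}` (the case `φ″ = 0`).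
[cite: Balaban1983RegularityDecay, (4.15)–(4.16) pp.591–592] -/
theorem gaussNorm_Kform_eq [NeZero n] (i : Fin D) {a : ℝ} (ha : 0 < a) :
    gaussNorm (Kform n i a) = gaussNorm (form419 n i a + (n : ℝ) • vecMulVec (fvec n i) (fvec n i)) := by
  have h := eq415_twoBlock (n := n) i ha 0 0
  rw [integral415_eq_integral416, sub_self, eq416_twoBlock i ha 0] at h
  have h0 : lhs414 n i a 0 0 = 0 := by
    simp [lhs414, qvec]
  rw [h0] at h
  simpa using h.symm

/-- **"Thus the inequality (4.14) is proved"** — in the block model the left side of (4.14) is EXACTLY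
`A₀|φ″(x′) − φ″(x)|²`: `a_k|φ″(x)|² + a_k|φ″(x′)|² − a_k²⟨φ″,Q_kG_k(Δ(x,x′),0)Q_k^*φ″⟩ = A₀(ψ₂ − ψ₁)²` ((4.15) =
(4.16) for every `φ″`, the constants cancelling). [cite: Balaban1983RegularityDecay, (4.14)–(4.16) pp.591–592] -/
theorem lhs414_eq [NeZero n] (i : Fin D) {a : ℝ} (ha : 0 < a) (ψ₁ ψ₂ : ℝ) :
    lhs414 n i a ψ₁ ψ₂ = A0 n i a * (ψ₂ - ψ₁) ^ 2 := by
  have h := eq415_twoBlock (n := n) i ha ψ₁ ψ₂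
  rw [integral415_eq_integral416, eq416_twoBlock i ha (ψ₂ - ψ₁), ← gaussNorm_Kform_eq i ha] at h
  have hN : 0 < gaussNorm (Kform n i a) := B2Eq228Conditioning.gaussNorm_pos (Kform_posDef i ha)
  have h2 := mul_left_cancel₀ hN.ne' h
  have h3 := Real.exp_injective h2
  linarith

/-- **(4.14) in the block model, with the print's constant**: *"a_k|φ″(x)|² + a_k|φ″(x′)|² − a_k²⟨φ″,
Q_kG_k(Δ(x,x′),0)Q_k^*φ″⟩ ≥ γ₀″|φ″(x′) − φ″(x)|²"* with `γ₀″ = (1 + 4max{1,a_k⁻¹})⁻¹`, for every `η = 1/n`, every `D`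
and every face direction `i`. [cite: Balaban1983RegularityDecay, (4.14) p.591, (4.22) p.593] -/
theorem ineq414_blockModel [NeZero n] (i : Fin D) {a : ℝ} (ha : 0 < a) (ψ₁ ψ₂ : ℝ) :
    (1 + 4 * max 1 a⁻¹)⁻¹ * (ψ₂ - ψ₁) ^ 2 ≤ lhs414 n i a ψ₁ ψ₂ := by
  rw [lhs414_eq i ha]
  exact mul_le_mul_of_nonneg_right (gamma0''_le_A0 i ha) (sq_nonneg _)

end

end Literature.MathematicalPhysics.QuantumFieldTheory.Balaban1983to89.B4Eq418TwoBlockA0
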